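import Summits.CriticalPhenomena.PercolationContinuityZ3.Theorems.PercNearOneGluingNoHeavyLowerTailCILStarTransfer
import HarnessLib

/-!
# `NoHeavyLowerTail` (stmt-CriticalPhenomena-4575) — relay-pendant members of an observer set are free
# (pendant stripping for set-champion stability)

Support file (prover `prim-hp-6`, hull-port cell, observer-set / OES technique; `--supports stmt-CriticalPhenomena-4575`).
No definitions, no named facts, no sorries.

Notation: `μ = prodBernoulli w` on `Fin n`, relays `A`, level `j`, `π(v) = {x ∈ A : v ↔ x}`, lightness
`r(x) = μ{|π(x)| ≤ j}`; for an observer SET `B`, `π(B) = ⋃_{y ∈ B} π(y)` and `{c ↮ B}` = "`c` is joined to no vertex of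
`B`"; SET-CHAMPION STABILITY `CS_w(B, c) : μ(c ↮ B, 1 ≤ |π(B)| ≤ j) ≤ μ(c ↮ B, |π(c)| ≤ j)`.  By the star transfer
(`Theorems.cil_of_starStability`) the crux's cumulative isolation lemma at an observer `o` is `CS_{G−o}(B, c)` for the
stars `B` of light Steiner neighbours of `o` (`c` a champion of `G − o`); the cell's open kernel ("the wall") is `|B| ≥ 2`.

A vertex `t ∉ A` is a RELAY-PENDANT of the weighted graph if all its positive-weight edges go to ONE vertex `z`
(`w s(t,u) = 0` for `u ∉ {t, z}`).  Write `w ∖ t` for the weights with the pairs at `t` switched off.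

* `CutObserver.setCS_of_pendantMember` — **pendant stripping.**  If `t ∈ B` is a relay-pendant hanging on `z`, `c ≠ t`,
  `z` is no lighter than `c` off `t` (`r_{w∖t}(z) ≤ r_{w∖t}(c)`), and `CS_{w∖t}(B ∖ {t}, c)` holds, then `CS_w(B, c)`.
  Proof: decompose along the star of `t` (`Literature.….KNPreFKG.real_eq_sum_inter_starEvent` with neighbour set `{z}`):
  on `σ_∅` (`t` isolated) both events of `CS_w(B, c)` are the events of `CS_{w∖t}(B ∖ {t}, c)` read off `ω ∩ {e | t ∉ e}`;
  on `σ_{{z}}` (the edge `t–z` open, nothing else at `t`) they are the events of `CS_{w∖t}((B ∖ {t}) ∪ {z}, c)`, an observer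
  set CONTAINING the vertex `z` no lighter than `c` — the lonely-cluster exchange `Literature.….observerSet_le_of_lonelier`
  (van den Berg–Häggström–Kahn Thm 1.5); the star is independent of the configuration off `t`
  (`CutObserver.measureReal_starEvent_inter_avoid`, `measureReal_preimage_avoid`).
  Iterating, every relay-pendant member of a star can be removed (the weights `w ∖ t` keep the other pendants pendant),
  so the wall for a light star `{v} ∪ {pendants}` reduces to CIL at the single vertex `v`: the class
  "one arbitrary light Steiner neighbour plus any number of relay-pendant ones" joins the proved classes
  (`Theorems.cil_of_oneLightSteinerNeighbour` is the pendant-free case).  Numerics of this seat (NOTES-gen1.md R10):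
  the analogous multi-affinity reduction for a member with ≥ 2 ports ("bistar") FAILS (per-vertex conditions violated
  in 2/201 light cases) — one port per stripped member is exactly the reach of this lemma.
-/

noncomputable section

namespace Summit.CriticalPhenomena.PercolationContinuityZ3.Theorems

open MeasureTheory Set Literature.Probability.LatticeModels Literature.Probability.Percolation
open scoped Classical BigOperators

variable {n : ℕ}

namespace CutObserver

open KNPreFKG in
/-- **Pendant stripping for set-champion stability.**  Let `t ∈ B`, `t ∉ A`, be a relay-pendant hanging on `z ≠ t`
(`w s(t,u) = 0` for every `u ≠ t, z`), let `c ≠ t`, and let `w ∖ t = fun e => if t ∉ e then w e else 0`.  If, under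
`prodBernoulli (w ∖ t)`, `z` is no lighter than `c` (`r(z) ≤ r(c)`) and `CS(B.erase t, c)` holds, then `CS_w(B, c)`:
`μ_w(c ↮ B, 1 ≤ |π(B)| ≤ j) ≤ μ_w(c ↮ B, |π(c)| ≤ j)`.
[cite: VandenbergHaggstromKahn2005, Thm. 1.5 (p. 7) — via `observerSet_le_of_lonelier`; KozmaNitzan2024, Lemma 5 (p. 13) — star decomposition] -/
theorem setCS_of_pendantMember (w : Sym2 (Fin n) → unitInterval) (A B : Finset (Fin n)) (c t z : Fin n) (j : ℕ)
    (htB : t ∈ B) (htA : t ∉ A) (hzt : z ≠ t) (hct : c ≠ t)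
    (hiso : ∀ u, u ≠ t → u ≠ z → w s(t, u) = 0)
    (hdom : (prodBernoulli fun e => if e ∈ {e : Sym2 (Fin n) | t ∉ e} then w e else 0).real
        {ξ : BondConfig (Fin n) | (A.filter fun a => ξ ∈ openConn z a).card ≤ j} ≤
      (prodBernoulli fun e => if e ∈ {e : Sym2 (Fin n) | t ∉ e} then w e else 0).real
        {ξ : BondConfig (Fin n) | (A.filter fun a => ξ ∈ openConn c a).card ≤ j})
    (hrest : (prodBernoulli fun e => if e ∈ {e : Sym2 (Fin n) | t ∉ e} then w e else 0).real
        {ξ : BondConfig (Fin n) | (∀ x ∈ B.erase t, ξ ∉ openConn c x) ∧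
          1 ≤ (A.filter fun a => ∃ x ∈ B.erase t, ξ ∈ openConn x a).card ∧
          (A.filter fun a => ∃ x ∈ B.erase t, ξ ∈ openConn x a).card ≤ j} ≤
      (prodBernoulli fun e => if e ∈ {e : Sym2 (Fin n) | t ∉ e} then w e else 0).real
        {ξ : BondConfig (Fin n) | (∀ x ∈ B.erase t, ξ ∉ openConn c x) ∧
          (A.filter fun a => ξ ∈ openConn c a).card ≤ j}) :
    (prodBernoulli w).real {ω : BondConfig (Fin n) | (∀ x ∈ B, ω ∉ openConn c x) ∧
        1 ≤ (A.filter fun a => ∃ x ∈ B, ω ∈ openConn x a).card ∧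
        (A.filter fun a => ∃ x ∈ B, ω ∈ openConn x a).card ≤ j} ≤
      (prodBernoulli w).real {ω : BondConfig (Fin n) | (∀ x ∈ B, ω ∉ openConn c x) ∧
        (A.filter fun a => ω ∈ openConn c a).card ≤ j} := by
  haveI : IsProbabilityMeasure (prodBernoulli w) := inferInstance
  set μ := prodBernoulli w with hμ
  set μ' := prodBernoulli (fun e => if e ∈ {e : Sym2 (Fin n) | t ∉ e} then w e else 0) with hμ'
  set L := {ω : BondConfig (Fin n) | (∀ x ∈ B, ω ∉ openConn c x) ∧
    1 ≤ (A.filter fun a => ∃ x ∈ B, ω ∈ openConn x a).card ∧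
    (A.filter fun a => ∃ x ∈ B, ω ∈ openConn x a).card ≤ j} with hL
  set R := {ω : BondConfig (Fin n) | (∀ x ∈ B, ω ∉ openConn c x) ∧
    (A.filter fun a => ω ∈ openConn c a).card ≤ j} with hR
  -- `H`-reachability (no edge at `t`)
  set R' : BondConfig (Fin n) → Fin n → Fin n → Prop := fun ω x y =>
    (openGraph (ω ∩ {e | t ∉ e})).Reachable x y with hR'
  -- the two observer sets off `t`
  set B₀ : Finset (Fin n) := B.erase t with hB₀
  set B₁ : Finset (Fin n) := insert z (B.erase t) with hB₁
  -- the `H`-predicates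
  set PL : Finset (Fin n) → BondConfig (Fin n) → Prop := fun D ξ =>
    (∀ x ∈ D, ¬ (openGraph ξ).Reachable c x) ∧
      1 ≤ (A.filter fun a => ∃ x ∈ D, (openGraph ξ).Reachable x a).card ∧
      (A.filter fun a => ∃ x ∈ D, (openGraph ξ).Reachable x a).card ≤ j with hPL
  set PR : Finset (Fin n) → BondConfig (Fin n) → Prop := fun D ξ =>
    (∀ x ∈ D, ¬ (openGraph ξ).Reachable c x) ∧ (A.filter fun a => (openGraph ξ).Reachable c a).card ≤ j
    with hPR
  -- star decomposition at `t` with neighbour set `{z}`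
  have htΓ : t ∉ ({z} : Finset (Fin n)) := by
    rw [Finset.mem_singleton]; exact fun h => hzt h.symm
  have hiso' : ∀ u, u ≠ t → u ∉ ({z} : Finset (Fin n)) → w s(t, u) = 0 := by
    intro u hut huz
    rw [Finset.mem_singleton] at huz
    exact hiso u hut huz
  rw [real_eq_sum_inter_starEvent w {z} t htΓ hiso' L, real_eq_sum_inter_starEvent w {z} t htΓ hiso' R]
  refine Finset.sum_le_sum fun D hD => ?_
  have hDsub : D ⊆ {z} := Finset.mem_powerset.1 hD
  -- basic facts valid on any star `σ_D` with `D ⊆ {z}`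
  -- (F1) on `σ_D`: a vertex not joined to `t` has the same cluster off `t`
  have hF1 : ∀ ω x y, ¬ (openGraph ω).Reachable x t → ((openGraph ω).Reachable x y ↔ R' ω x y) := by
    intro ω x y hxt
    exact ⟨fun h => reachable_avoiding_of_not_reachable hxt h, fun h => reachable_mono inter_subset_left h⟩
  rcases Finset.subset_singleton_iff.1 hDsub with rfl | rfl
  · ---------------------------------------------------------------- σ_∅ : `t` isolated
    set σ := starEvent t (↑(∅ : Finset (Fin n)) : Set (Fin n)) with hσdef
    have hσ' : ∀ ω ∈ σ, ω ∈ starEvent t (∅ : Set (Fin n)) := by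
      intro ω hω; simpa [hσdef] using hω
    -- on σ_∅: nothing is joined to `t`
    have hnt : ∀ ω ∈ σ, ∀ x, x ≠ t → ¬ (openGraph ω).Reachable x t := by
      intro ω hω x hxt h
      exact not_reachable_of_mem_starEvent_empty (hσ' ω hω) hxt h.symm
    -- (a) L ∩ σ ⊆ σ ∩ {PL B₀ (ω ∩ {t ∉ e})}
    have ha : L ∩ σ ⊆ σ ∩ {ω | PL B₀ (ω ∩ {e | t ∉ e})} := by
      rintro ω ⟨⟨hLc, hL1, hLj⟩, hω⟩
      refine ⟨hω, ?_, ?_, ?_⟩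
      · intro x hx hcx
        have hxt : x ≠ t := (Finset.mem_erase.1 hx).1
        exact hLc x (Finset.mem_of_mem_erase hx) (reachable_mono inter_subset_left hcx)
      · refine le_trans hL1 (Finset.card_le_card fun a ha => ?_)
        rw [Finset.mem_filter] at ha ⊢
        obtain ⟨haA, x, hxB, hxa⟩ := ha
        have hat : a ≠ t := fun h => htA (h ▸ haA)
        by_cases hxt : x = t
        · subst hxt
          exact absurd (hxa : (openGraph ω).Reachable x a) (fun h => hnt ω hω a hat h.symm)
        · exact ⟨haA, x, Finset.mem_erase.2 ⟨hxt, hxB⟩, (hF1 ω x a (hnt ω hω x hxt)).1 hxa⟩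
      · refine le_trans (Finset.card_le_card fun a ha => ?_) hLj
        rw [Finset.mem_filter] at ha ⊢
        obtain ⟨haA, x, hxB, hxa⟩ := ha
        exact ⟨haA, x, Finset.mem_of_mem_erase hxB, reachable_mono inter_subset_left hxa⟩
    -- (b) σ ∩ {PR B₀ (ω ∩ {t ∉ e})} ⊆ R ∩ σ
    have hb : σ ∩ {ω | PR B₀ (ω ∩ {e | t ∉ e})} ⊆ R ∩ σ := by
      rintro ω ⟨hω, hRc, hRj⟩
      refine ⟨⟨?_, ?_⟩, hω⟩
      · intro x hxB hcx
        by_cases hxt : x = t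
        · subst hxt; exact hnt ω hω c hct hcx
        · exact hRc x (Finset.mem_erase.2 ⟨hxt, hxB⟩) ((hF1 ω c x (hnt ω hω c hct)).1 hcx)
      · show (A.filter fun a => ω ∈ openConn c a).card ≤ j
        have heq : (A.filter fun a => ω ∈ openConn c a) =
            (A.filter fun a => (openGraph (ω ∩ {e | t ∉ e})).Reachable c a) :=
          Finset.filter_congr fun a _ => hF1 ω c a (hnt ω hω c hct)
        rw [heq]; exact hRj
    -- independence and transfer
    have hdL : μ.real (σ ∩ {ω | PL B₀ (ω ∩ {e | t ∉ e})}) = μ.real σ * μ.real {ω | PL B₀ (ω ∩ {e | t ∉ e})} :=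
      measureReal_starEvent_inter_avoid w t _ (PL B₀)
    have hdR : μ.real (σ ∩ {ω | PR B₀ (ω ∩ {e | t ∉ e})}) = μ.real σ * μ.real {ω | PR B₀ (ω ∩ {e | t ∉ e})} :=
      measureReal_starEvent_inter_avoid w t _ (PR B₀)
    have e2 : {ω : BondConfig (Fin n) | PL B₀ (ω ∩ {e | t ∉ e})} =
        {ω : BondConfig (Fin n) | ω ∩ {e | t ∉ e} ∈
          {ξ : BondConfig (Fin n) | (∀ x ∈ B.erase t, ξ ∉ openConn c x) ∧
            1 ≤ (A.filter fun a => ∃ x ∈ B.erase t, ξ ∈ openConn x a).card ∧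
            (A.filter fun a => ∃ x ∈ B.erase t, ξ ∈ openConn x a).card ≤ j}} := by
      ext ω; simp only [hPL, mem_setOf_eq, filter_avoid_exists_eq]; exact Iff.rfl
    have e3 : {ω : BondConfig (Fin n) | PR B₀ (ω ∩ {e | t ∉ e})} =
        {ω : BondConfig (Fin n) | ω ∩ {e | t ∉ e} ∈
          {ξ : BondConfig (Fin n) | (∀ x ∈ B.erase t, ξ ∉ openConn c x) ∧
            (A.filter fun a => ξ ∈ openConn c a).card ≤ j}} := by
      ext ω; simp only [hPR, mem_setOf_eq, filter_avoid_eq]; exact Iff.rfl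
    have hkey : μ.real {ω | PL B₀ (ω ∩ {e | t ∉ e})} ≤ μ.real {ω | PR B₀ (ω ∩ {e | t ∉ e})} := by
      rw [e2, e3, measureReal_preimage_avoid, measureReal_preimage_avoid]; exact hrest
    calc μ.real (L ∩ σ) ≤ μ.real (σ ∩ {ω | PL B₀ (ω ∩ {e | t ∉ e})}) := measureReal_mono ha (measure_ne_top _ _)
      _ = μ.real σ * μ.real {ω | PL B₀ (ω ∩ {e | t ∉ e})} := hdL
      _ ≤ μ.real σ * μ.real {ω | PR B₀ (ω ∩ {e | t ∉ e})} :=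
          mul_le_mul_of_nonneg_left hkey measureReal_nonneg
      _ = μ.real (σ ∩ {ω | PR B₀ (ω ∩ {e | t ∉ e})}) := hdR.symm
      _ ≤ μ.real (R ∩ σ) := measureReal_mono hb (measure_ne_top _ _)
  · ---------------------------------------------------------------- σ_{z} : the edge `t–z` open, `t` a leaf
    set σ := starEvent t (↑({z} : Finset (Fin n)) : Set (Fin n)) with hσdef
    have hzmem : z ∈ (↑({z} : Finset (Fin n)) : Set (Fin n)) := by simp
    -- on σ_z: `t ~ a` iff `z ~' a` (for `a ≠ t`), and `x ~ t` gives `z ~' x`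
    have hzt' : ∀ ω ∈ σ, ∀ x, x ≠ t → (openGraph ω).Reachable x t → R' ω z x := by
      intro ω hω x hxt hxtr
      obtain ⟨y, hy, hyx⟩ := exists_avoid_of_reachable_star hω hxt hxtr.symm
      have : y = z := by simpa using hy
      subst this; exact hyx
    have htz : ∀ ω ∈ σ, ∀ a, R' ω z a → (openGraph ω).Reachable t a := by
      intro ω hω a hza
      exact reachable_of_mem_star hω hzt hzmem hza
    -- (a) L ∩ σ ⊆ σ ∩ {PL B₁ (ω ∩ {t ∉ e})}
    have ha : L ∩ σ ⊆ σ ∩ {ω | PL B₁ (ω ∩ {e | t ∉ e})} := by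
      rintro ω ⟨⟨hLc, hL1, hLj⟩, hω⟩
      have hct' : ¬ (openGraph ω).Reachable c t := hLc t htB
      refine ⟨hω, ?_, ?_, ?_⟩
      · intro x hx hcx
        rcases Finset.mem_insert.1 hx with rfl | hx'
        · -- x = z: c ~' z ⇒ c ~ t
          exact hct' ((reachable_mono inter_subset_left hcx).trans (htz ω hω x (SimpleGraph.Reachable.refl _)).symm)
        · exact hLc x (Finset.mem_of_mem_erase hx') (reachable_mono inter_subset_left hcx)
      · refine le_trans hL1 (Finset.card_le_card fun a ha => ?_)
        rw [Finset.mem_filter] at ha ⊢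
        obtain ⟨haA, x, hxB, hxa⟩ := ha
        have hat : a ≠ t := fun h => htA (h ▸ haA)
        refine ⟨haA, ?_⟩
        by_cases hxt : x = t
        · subst hxt
          exact ⟨z, Finset.mem_insert_self _ _, hzt' ω hω a hat (SimpleGraph.Reachable.symm hxa)⟩
        · by_cases hxtr : (openGraph ω).Reachable x t
          · exact ⟨z, Finset.mem_insert_self _ _,
              hzt' ω hω a hat ((SimpleGraph.Reachable.symm hxa).trans hxtr)⟩
          · exact ⟨x, Finset.mem_insert_of_mem (Finset.mem_erase.2 ⟨hxt, hxB⟩), (hF1 ω x a hxtr).1 hxa⟩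
      · refine le_trans (Finset.card_le_card fun a ha => ?_) hLj
        rw [Finset.mem_filter] at ha ⊢
        obtain ⟨haA, x, hxB, hxa⟩ := ha
        rcases Finset.mem_insert.1 hxB with rfl | hx'
        · exact ⟨haA, t, htB, htz ω hω a hxa⟩
        · exact ⟨haA, x, Finset.mem_of_mem_erase hx', reachable_mono inter_subset_left hxa⟩
    -- (b) σ ∩ {PR B₁ (ω ∩ {t ∉ e})} ⊆ R ∩ σ
    have hb : σ ∩ {ω | PR B₁ (ω ∩ {e | t ∉ e})} ⊆ R ∩ σ := by
      rintro ω ⟨hω, hRc, hRj⟩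
      have hcz : ¬ R' ω c z := hRc z (Finset.mem_insert_self _ _)
      have hct' : ¬ (openGraph ω).Reachable c t := fun h => hcz (hzt' ω hω c hct h).symm
      refine ⟨⟨?_, ?_⟩, hω⟩
      · intro x hxB hcx
        by_cases hxt : x = t
        · subst hxt; exact hct' hcx
        · exact hRc x (Finset.mem_insert_of_mem (Finset.mem_erase.2 ⟨hxt, hxB⟩)) ((hF1 ω c x hct').1 hcx)
      · show (A.filter fun a => ω ∈ openConn c a).card ≤ j
        have heq : (A.filter fun a => ω ∈ openConn c a) =
            (A.filter fun a => (openGraph (ω ∩ {e | t ∉ e})).Reachable c a) :=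
          Finset.filter_congr fun a _ => hF1 ω c a hct'
        rw [heq]; exact hRj
    -- independence and transfer; the key inequality is the lonely-cluster exchange with pivot `z ∈ B₁`
    have hdL : μ.real (σ ∩ {ω | PL B₁ (ω ∩ {e | t ∉ e})}) = μ.real σ * μ.real {ω | PL B₁ (ω ∩ {e | t ∉ e})} :=
      measureReal_starEvent_inter_avoid w t _ (PL B₁)
    have hdR : μ.real (σ ∩ {ω | PR B₁ (ω ∩ {e | t ∉ e})}) = μ.real σ * μ.real {ω | PR B₁ (ω ∩ {e | t ∉ e})} :=
      measureReal_starEvent_inter_avoid w t _ (PR B₁)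
    have e2 : {ω : BondConfig (Fin n) | PL B₁ (ω ∩ {e | t ∉ e})} =
        {ω : BondConfig (Fin n) | ω ∩ {e | t ∉ e} ∈
          {ξ : BondConfig (Fin n) | (∀ x ∈ B₁, ξ ∉ openConn c x) ∧
            1 ≤ (A.filter fun a => ∃ x ∈ B₁, ξ ∈ openConn x a).card ∧
            (A.filter fun a => ∃ x ∈ B₁, ξ ∈ openConn x a).card ≤ j}} := by
      ext ω; simp only [hPL, mem_setOf_eq, filter_avoid_exists_eq]; exact Iff.rfl
    have e3 : {ω : BondConfig (Fin n) | PR B₁ (ω ∩ {e | t ∉ e})} =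
        {ω : BondConfig (Fin n) | ω ∩ {e | t ∉ e} ∈
          {ξ : BondConfig (Fin n) | (∀ x ∈ B₁, ξ ∉ openConn c x) ∧
            (A.filter fun a => ξ ∈ openConn c a).card ≤ j}} := by
      ext ω; simp only [hPR, mem_setOf_eq, filter_avoid_eq]; exact Iff.rfl
    have hkey : μ.real {ω | PL B₁ (ω ∩ {e | t ∉ e})} ≤ μ.real {ω | PR B₁ (ω ∩ {e | t ∉ e})} := by
      rw [e2, e3, measureReal_preimage_avoid, measureReal_preimage_avoid]
      have key := observerSet_le_of_lonelier (fun e => if e ∈ {e : Sym2 (Fin n) | t ∉ e} then w e else 0)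
        A B₁ z c (Finset.mem_insert_self _ _) j hdom
      convert key using 12
    calc μ.real (L ∩ σ) ≤ μ.real (σ ∩ {ω | PL B₁ (ω ∩ {e | t ∉ e})}) := measureReal_mono ha (measure_ne_top _ _)
      _ = μ.real σ * μ.real {ω | PL B₁ (ω ∩ {e | t ∉ e})} := hdL
      _ ≤ μ.real σ * μ.real {ω | PR B₁ (ω ∩ {e | t ∉ e})} :=
          mul_le_mul_of_nonneg_left hkey measureReal_nonneg
      _ = μ.real (σ ∩ {ω | PR B₁ (ω ∩ {e | t ∉ e})}) := hdR.symm
      _ ≤ μ.real (R ∩ σ) := measureReal_mono hb (measure_ne_top _ _)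

end CutObserver

end Summit.CriticalPhenomena.PercolationContinuityZ3.Theorems

end
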